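import Mathlib.Analysis.Calculus.BumpFunction.Normed
import Mathlib.Analysis.Calculus.BumpFunction.FiniteDimension
import Mathlib.Analysis.Calculus.ParametricIntegral
import Mathlib.Analysis.Calculus.MeanValue
import Mathlib.MeasureTheory.Integral.Bochner.ContinuousLinearMap
import Mathlib.MeasureTheory.Integral.Prod
import Mathlib.MeasureTheory.Measure.Haar.NormedSpace
import Mathlib.Topology.UniformSpace.HeineCantor
import Mathlib.Topology.MetricSpace.HausdorffDistance
import Mathlib.Topology.Connected.Clopen
import Mathlib.Analysis.InnerProductSpace.Projection.FiniteDimensional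
import Literature.Geometry.GeometricMeasureTheory.CurrentsVariationMeasure
import Literature.Geometry.GeometricMeasureTheory.CurrentsPushforward
import Literature.Geometry.GeometricMeasureTheory.CurrentsRepresentable
import Literature.Geometry.GeometricMeasureTheory.FlatComplete
import Literature.Geometry.GeometricMeasureTheory.CurrentsSupportTheorem
import Literature.Geometry.GeometricMeasureTheory.ApproxTangentChart
import Literature.Geometry.GeometricMeasureTheory.RectifiableAdd
import HarnessLib

/-!
# The constancy theorem: zero distributional gradient, and rectifiable currents on faces

Support file for the proof of the named fact
`Literature.Geometry.GeometricMeasureTheory.Federer1969_compactness_integralCurrents`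
(Federer–Fleming compactness, [Federer1969, 4.2.17 (2)]), on the way to the deformation theorem
4.2.9: the ingredient of 4.2.3/4.2.5 that identifies a current carried by the `m`-skeleton of a
cubical subdivision, with boundary in the `(m-1)`-skeleton, face by face with a constant multiple
of the oriented face — Federer's **constancy theorem** (4.1.4, 4.1.7: "if `T ∈ 𝒟_n(U)` with
`∂T = 0` and `U` is connected then `T` is a constant multiple of `𝐄ⁿ ⌞ U`", and 4.1.31 (2) for
submanifolds), in the form needed for integral currents, where the constant is an integer
(4.1.28, 4.2.3: "if also `T ∈ 𝓡_m(ℝⁿ)`, then `r_1, …, r_μ` are integers").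

## Contents

* `ZeroGradient.exists_const` — **the analytic core** (Federer's proof of 4.1.4/4.1.7 by
  smoothing, here for measures): for a finite measure `μ` on a finite-dimensional real normed
  space with Haar measure `ν`, a density `θ ∈ L¹(μ)` and a connected open `Ω` such that
  `∫ (D_v g) θ dμ = 0` for all smooth `g` compactly supported in `Ω` and all `v` (`ZeroGradient.Hyp`),
  there is a constant `c` with `∫_A θ dμ = c ν(A)` for all Borel `A ⊆ Ω` of finite `ν`-measure.
  Proof: the mollifications `u_ε(x) = ∫ k_ε(y - x) θ(y) dμ(y)` (`ZeroGradient.moll`) are smooth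
  with `Du_ε(x) = -∫ θ D[k_ε(· - x)] dμ = 0` when `B̄(x, ε) ⊆ Ω` (differentiation under the
  integral, the hypothesis applied to the translated kernel), hence locally constant; Fubini gives
  `∫ g u_ε dν = ∫ (k_ε ∗ g) θ dμ → ∫ g θ dμ`, so `∫ g θ dμ = c_B ∫ g dν` for continuous `g`
  supported in a small ball `B`; overlapping balls have the same constant, connectedness makes it
  global (`IsPreconnected.induction₂'`), and two finite measures agreeing on the open subsets of
  a ball agree on its Borel subsets (`Measure.ext_of_isOpen_subset`).
* `ZeroGradient.exists_const_plane` — the same on an affine plane `p₀ + P₀` of an inner product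
  space, for a measure concentrated on the plane and derivatives along `P₀` only, with
  `ν = 𝓗^{dim P₀}` (`μHE`) on the plane (transport through the isometry `y ↦ p₀ + y`,
  `ZeroGradient.planeEmb`, and a cutoff in the normal directions).
* `Current.IsRectifiable.exists_int_restrictSet_eq_face` — **constancy theorem for
  rectifiable currents on an open face**: if `S` is a rectifiable `(k+1)`-current in `V`, `U` is
  open, `spt S ∩ U ⊆ p₀ + P₀` (`dim P₀ = k + 1`, orthonormal frame `e`), `U ∩ (p₀ + P₀)` is
  connected of finite `𝓗^{k+1}`-measure and `∂S(φ) = 0` for all `φ` supported in `U`, then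
  `S ⌞ U = [U ∩ (p₀ + P₀), a, e]` for an integer `a`. Proof: `S ⌞ U = [W₀, θ, ξ]` with
  `W₀ ⊆ U ∩ (p₀ + P₀)` (`‖S‖` lives on `spt S`, `Current.variation_sdiff_support`); at a.e. point
  of `W₀` the approximate tangent plane lies in `P₀` (`approxTangentCone_subset_of_subset_plane`),
  so `ξ₁ ∧ ⋯ ∧ ξ_{k+1} = ± e₁ ∧ ⋯ ∧ e_{k+1}` (`IsRectifiableData.ae_frameVector_eq_or`) and
  `S ⌞ U = (η 𝓗^{k+1} ⌞ W₀) ∧ e` with an integer-valued density `η = ±θ`; testing `∂S = 0` on the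
  forms `g · (e ∘ i.succAbove)^*` (`frameCovector`, whose exterior derivative evaluated on `e` is
  `(-1)ⁱ D_{eᵢ} g`, `extDerivCLM_smulCovectorCLM_frameCovector_apply`) shows that `η 𝓗^{k+1} ⌞ W₀`
  has zero tangential gradient on `U`, whence `η 1_{W₀} = c` a.e. on the face by the plane
  lemma, and `c ∈ ℤ`.

Definitions made here (all with bodies): the bump `ZeroGradient.bump`, the mollifying kernel and
mollification `ZeroGradient.kernel`, `ZeroGradient.moll`, the smoothing `ZeroGradient.sconv`, the
hypothesis `ZeroGradient.Hyp`, the plane maps `ZeroGradient.planeEmb`, `ZeroGradient.planeProj`,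
the frame coordinates `frameCoord` and the dual covector of a frame `frameCovector`.
No named facts.

## References

* H. Federer, *Geometric Measure Theory*, Springer 1969: 4.1.4 and 4.1.7 (constancy theorem,
  proof by smoothing), 4.1.28 (4)–(5), 4.1.31 (2), 4.2.3, 4.2.5 (held copy
  `lit book:federernd-geometric-measure-theory`, PDF pp. 301, 325–329, 337–341) [Federer1969].
-/

noncomputable section

open MeasureTheory TopologicalSpace Set Filter Metric Function
open scoped Distributions ENNReal NNReal Topology ContDiff

namespace Literature.Geometry.GeometricMeasureTheory

namespace ZeroGradient

variable {V : Type*} [NormedAddCommGroup V] [NormedSpace ℝ V] [FiniteDimensional ℝ V]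
  [MeasurableSpace V] [BorelSpace V]

/-- The bump of radius `ε` centred at `x`: inner radius `ε/2`, outer radius `ε`. [folklore] -/
def bump (x : V) {ε : ℝ} (hε : 0 < ε) : ContDiffBump x := ⟨ε / 2, ε, half_pos hε, half_lt_self hε⟩

variable (ν : Measure V) [ν.IsAddHaarMeasure]

/-- The mollifying kernel `k_ε`: the `ν`-normalized bump of radius `ε` centred at `0`. [folklore] -/
def kernel {ε : ℝ} (hε : 0 < ε) : V → ℝ := (bump (0 : V) hε).normed ν

omit [BorelSpace V] [ν.IsAddHaarMeasure] in
/-- The kernel is smooth. [folklore] -/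
theorem contDiff_kernel {ε : ℝ} (hε : 0 < ε) : ContDiff ℝ ∞ (kernel ν hε) :=
  (bump (0 : V) hε).contDiff_normed

omit [BorelSpace V] [ν.IsAddHaarMeasure] in
/-- The kernel is continuous. [folklore] -/
theorem continuous_kernel {ε : ℝ} (hε : 0 < ε) : Continuous (kernel ν hε) :=
  (bump (0 : V) hε).continuous_normed

/-- `tsupport k_ε = B̄(0, ε)`. [folklore] -/
theorem tsupport_kernel {ε : ℝ} (hε : 0 < ε) : tsupport (kernel ν hε) = closedBall 0 ε :=
  (bump (0 : V) hε).tsupport_normed_eq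

/-- `support k_ε = B(0, ε)`. [folklore] -/
theorem support_kernel {ε : ℝ} (hε : 0 < ε) : support (kernel ν hε) = ball 0 ε :=
  (bump (0 : V) hε).support_normed_eq

/-- The kernel has compact support. [folklore] -/
theorem hasCompactSupport_kernel {ε : ℝ} (hε : 0 < ε) : HasCompactSupport (kernel ν hε) :=
  (bump (0 : V) hε).hasCompactSupport_normed

omit [BorelSpace V] [ν.IsAddHaarMeasure] in
/-- `k_ε ≥ 0`. [folklore] -/
theorem kernel_nonneg {ε : ℝ} (hε : 0 < ε) (x : V) : 0 ≤ kernel ν hε x :=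
  (bump (0 : V) hε).nonneg_normed x

omit [BorelSpace V] [ν.IsAddHaarMeasure] in
/-- The kernel is even: `k_ε(-x) = k_ε(x)`. [folklore] -/
theorem kernel_neg {ε : ℝ} (hε : 0 < ε) (x : V) : kernel ν hε (-x) = kernel ν hε x :=
  (bump (0 : V) hε).normed_neg x

/-- `∫ k_ε dν = 1`. [folklore] -/
theorem integral_kernel {ε : ℝ} (hε : 0 < ε) : ∫ x, kernel ν hε x ∂ν = 1 :=
  (bump (0 : V) hε).integral_normed

/-- The kernel vanishes outside the open `ε`-ball. [folklore] -/
theorem kernel_eq_zero {ε : ℝ} (hε : 0 < ε) {x : V} (hx : ε ≤ ‖x‖) : kernel ν hε x = 0 := by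
  have : x ∉ support (kernel ν hε) := by
    rw [support_kernel]; simpa using hx
  simpa [mem_support] using this

/-- A common bound for the kernel and its derivative. [folklore] -/
theorem exists_kernel_bound {ε : ℝ} (hε : 0 < ε) :
    ∃ M, 0 < M ∧ (∀ x : V, |kernel ν hε x| ≤ M) ∧ ∀ x : V, ‖fderiv ℝ (kernel ν hε) x‖ ≤ M := by
  obtain ⟨C₁, hC₁⟩ := (hasCompactSupport_kernel ν hε).exists_bound_of_continuous
    (continuous_kernel ν hε)
  obtain ⟨C₂, hC₂⟩ := ((hasCompactSupport_kernel ν hε).fderiv ℝ).exists_bound_of_continuous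
    ((contDiff_kernel ν hε).continuous_fderiv (by simp))
  refine ⟨max (max C₁ C₂) 1, by positivity, fun x => ?_, fun x => ?_⟩
  · rw [← Real.norm_eq_abs]
    exact (hC₁ x).trans ((le_max_left _ _).trans (le_max_left _ _))
  · exact (hC₂ x).trans ((le_max_right _ _).trans (le_max_left _ _))

/-- `∫ k_ε(y - x) dν(x) = 1`. [folklore] -/
theorem integral_kernel_sub {ε : ℝ} (hε : 0 < ε) (y : V) : ∫ x, kernel ν hε (y - x) ∂ν = 1 := by
  have : ∀ x, kernel ν hε (y - x) = kernel ν hε (x - y) := fun x => by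
    rw [← neg_sub, kernel_neg]
  simp_rw [this, integral_sub_right_eq_self (fun x => kernel ν hε x) y]
  exact integral_kernel ν hε

/-! #### The mollified density -/

variable (μ : Measure V) (θ : V → ℝ)

/-- **The mollification `u_ε(x) = ∫ k_ε(y − x) θ(y) dμ(y)`** of the measure `θ μ`. [folklore] -/
def moll {ε : ℝ} (hε : 0 < ε) (x : V) : ℝ := ∫ y, kernel ν hε (y - x) * θ y ∂μ

/-- The **zero-gradient hypothesis** on an open set `Ω`: `∫ (D_v g) θ dμ = 0` for every smooth
compactly supported `g` with `tsupport g ⊆ Ω` and every direction `v`. [folklore] -/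
def Hyp (Ω : Set V) : Prop :=
  ∀ g : V → ℝ, ContDiff ℝ ∞ g → HasCompactSupport g → tsupport g ⊆ Ω →
    ∀ v : V, ∫ y, fderiv ℝ g y v * θ y ∂μ = 0

variable {θ} (hθ : Integrable θ μ)

include hθ in
/-- The integrand of the mollification is integrable. [folklore] -/
theorem integrable_kernel_mul {ε : ℝ} (hε : 0 < ε) (x : V) :
    Integrable (fun y => kernel ν hε (y - x) * θ y) μ := by
  obtain ⟨M, hM, hk, -⟩ := exists_kernel_bound ν hε
  refine Integrable.mono' (hθ.norm.const_mul M) ?_ (Eventually.of_forall fun y => ?_)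
  · exact (((continuous_kernel ν hε).comp (continuous_id.sub continuous_const)).aestronglyMeasurable.mul
      hθ.1)
  · rw [Real.norm_eq_abs, abs_mul, Real.norm_eq_abs]
    exact mul_le_mul_of_nonneg_right (hk _) (abs_nonneg _)

include hθ in
/-- **The mollification is differentiable**, with derivative
`Du_ε(x) = −∫ θ(y) Dk_ε(y − x) dμ(y)` (differentiation under the integral sign).
[folklore] -/
theorem hasFDerivAt_moll {ε : ℝ} (hε : 0 < ε) (x : V) :
    HasFDerivAt (moll ν μ θ hε) (∫ y, -(θ y • fderiv ℝ (kernel ν hε) (y - x)) ∂μ) x := by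
  obtain ⟨M, hM, hk, hdk⟩ := exists_kernel_bound ν hε
  have hkd : Differentiable ℝ (kernel ν hε) := (contDiff_kernel ν hε).differentiable (by simp)
  have hderiv : ∀ y z : V, HasFDerivAt (fun x => kernel ν hε (y - x) * θ y)
      (-(θ y • fderiv ℝ (kernel ν hε) (y - z))) z := by
    intro y z
    have h1 : HasFDerivAt (fun x : V => y - x) (-(ContinuousLinearMap.id ℝ V)) z :=
      (hasFDerivAt_id z).const_sub y
    have h2 := ((hkd (y - z)).hasFDerivAt.comp z h1).mul_const (θ y)
    refine h2.congr_fderiv ?_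
    rw [ContinuousLinearMap.comp_neg, ContinuousLinearMap.comp_id, smul_neg]
  refine hasFDerivAt_integral_of_dominated_of_fderiv_le (F := fun x y => kernel ν hε (y - x) * θ y)
    (F' := fun x y => -(θ y • fderiv ℝ (kernel ν hε) (y - x))) (bound := fun y => ‖θ y‖ * M)
    (s := univ) univ_mem (Eventually.of_forall fun x => (integrable_kernel_mul ν μ hθ hε x).1)
    (integrable_kernel_mul ν μ hθ hε x) ?_ ?_ (hθ.norm.mul_const M) ?_
  · refine (hθ.1.smul ?_).neg
    exact (((contDiff_kernel ν hε).continuous_fderiv (by simp)).comp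
      (continuous_id.sub continuous_const)).aestronglyMeasurable
  · refine Eventually.of_forall fun y z _ => ?_
    rw [norm_neg, norm_smul]
    exact mul_le_mul_of_nonneg_left (hdk _) (norm_nonneg _)
  · exact Eventually.of_forall fun y z _ => hderiv y z

include hθ in
/-- The mollification is continuous. [folklore] -/
theorem continuous_moll {ε : ℝ} (hε : 0 < ε) : Continuous (moll ν μ θ hε) :=
  continuous_iff_continuousAt.2 fun x => (hasFDerivAt_moll ν μ hθ hε x).continuousAt

include hθ in
/-- The mollification is differentiable. [folklore] -/
theorem differentiable_moll {ε : ℝ} (hε : 0 < ε) : Differentiable ℝ (moll ν μ θ hε) :=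
  fun x => (hasFDerivAt_moll ν μ hθ hε x).differentiableAt

variable {Ω : Set V}

include hθ in
/-- Under the zero-gradient hypothesis, **`Du_ε(x) = 0` whenever `B̄(x, ε) ⊆ Ω`**. [folklore] -/
theorem fderiv_moll_eq_zero (H : Hyp μ θ Ω) {ε : ℝ} (hε : 0 < ε) {x : V}
    (hx : closedBall x ε ⊆ Ω) : fderiv ℝ (moll ν μ θ hε) x = 0 := by
  obtain ⟨M, hM, hk, hdk⟩ := exists_kernel_bound ν hε
  rw [(hasFDerivAt_moll ν μ hθ hε x).fderiv]
  have hint : Integrable (fun y => -(θ y • fderiv ℝ (kernel ν hε) (y - x))) μ := by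
    refine (Integrable.mono' (hθ.norm.mul_const M) (hθ.1.smul ?_) (Eventually.of_forall fun y => ?_)).neg
    · exact (((contDiff_kernel ν hε).continuous_fderiv (by simp)).comp
        (continuous_id.sub continuous_const)).aestronglyMeasurable
    · rw [Pi.smul_apply', norm_smul]
      exact mul_le_mul_of_nonneg_left (hdk _) (norm_nonneg _)
  ext v
  rw [ContinuousLinearMap.integral_apply hint v]
  have h0 : ((0 : V →L[ℝ] ℝ) v) = 0 := rfl
  have h0' : (fun y => (-(θ y • fderiv ℝ (kernel ν hε) (y - x))) v) =
      fun y => -(θ y * fderiv ℝ (kernel ν hε) (y - x) v) := by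
    ext y; rfl
  rw [h0, h0', integral_neg, neg_eq_zero]
  -- the test function `g = k_ε(· - x)`
  set g : V → ℝ := fun y => kernel ν hε (y - x) with hg
  have hgs : ContDiff ℝ ∞ g := (contDiff_kernel ν hε).comp (contDiff_id.sub contDiff_const)
  have hsupp : support g ⊆ ball x ε := by
    intro y hy
    rw [mem_support] at hy
    by_contra h
    exact hy (kernel_eq_zero ν hε (by rw [mem_ball, dist_eq_norm] at h; exact not_lt.1 h))
  have htsupp : tsupport g ⊆ closedBall x ε :=
    (closure_mono hsupp).trans closure_ball_subset_closedBall
  have hgc : HasCompactSupport g :=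
    IsCompact.of_isClosed_subset (isCompact_closedBall x ε) isClosed_closure htsupp
  have hfd : ∀ y, fderiv ℝ g y = fderiv ℝ (kernel ν hε) (y - x) := by
    intro y
    have h1 : HasFDerivAt (fun y : V => y - x) (ContinuousLinearMap.id ℝ V) y :=
      (hasFDerivAt_id y).sub_const x
    have h2 := (((contDiff_kernel ν hε).differentiable (by simp)) (y - x)).hasFDerivAt.comp y h1
    rw [ContinuousLinearMap.comp_id] at h2
    exact h2.fderiv
  have := H g hgs hgc (htsupp.trans hx) v
  simp_rw [hfd] at this
  rw [← this]
  congr 1 with a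
  rw [mul_comm]

include hθ in
/-- **The mollification is constant on balls well inside `Ω`**: if `B̄(x₁, r + ε) ⊆ Ω` then
`u_ε` is constant on `B(x₁, r)`. [folklore] -/
theorem moll_eq_moll (H : Hyp μ θ Ω) {ε : ℝ} (hε : 0 < ε) {x₁ : V} {r : ℝ}
    (hΩ : closedBall x₁ (r + ε) ⊆ Ω) {x x' : V} (hx : x ∈ ball x₁ r) (hx' : x' ∈ ball x₁ r) :
    moll ν μ θ hε x = moll ν μ θ hε x' := by
  refine isOpen_ball.is_const_of_fderiv_eq_zero (convex_ball x₁ r).isPreconnected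
    (differentiable_moll ν μ hθ hε).differentiableOn (fun z hz => ?_) hx hx'
  refine fderiv_moll_eq_zero ν μ hθ H hε fun w hw => hΩ ?_
  rw [mem_closedBall] at hw ⊢
  rw [mem_ball] at hz
  linarith [dist_triangle w z x₁]

/-! #### Smoothing of continuous functions by the kernel -/

/-- `(k_ε ∗ g)(y) = ∫ g(x) k_ε(y − x) dν(x)`. [folklore] -/
def sconv (g : V → ℝ) {ε : ℝ} (hε : 0 < ε) (y : V) : ℝ := ∫ x, g x * kernel ν hε (y - x) ∂ν

/-- **Uniform approximation**: `|(k_ε ∗ g)(y) − g(y)| ≤ δ` if `|g(x) − g(y)| ≤ δ` for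
`dist x y ≤ ε`. [folklore] -/
theorem abs_sconv_sub_le {g : V → ℝ} (hg : Continuous g) {ε : ℝ} (hε : 0 < ε) {δ : ℝ} (y : V)
    (hδ : ∀ x, dist x y ≤ ε → |g x - g y| ≤ δ) : |sconv ν g hε y - g y| ≤ δ := by
  have hδ0 : 0 ≤ δ := (abs_nonneg _).trans (hδ y (by simp [hε.le]))
  have hk : Continuous fun x => kernel ν hε (y - x) :=
    (continuous_kernel ν hε).comp (continuous_const.sub continuous_id)
  have hks : HasCompactSupport fun x => kernel ν hε (y - x) := by
    refine IsCompact.of_isClosed_subset (isCompact_closedBall y ε) isClosed_closure ?_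
    refine closure_minimal (fun x hx => ?_) isClosed_closedBall
    rw [mem_support] at hx
    rw [mem_closedBall, dist_eq_norm, ← norm_neg, neg_sub]
    by_contra h
    exact hx (kernel_eq_zero ν hε (not_le.1 h).le)
  have hi1 : Integrable (fun x => g x * kernel ν hε (y - x)) ν :=
    (hg.mul hk).integrable_of_hasCompactSupport hks.mul_left
  have hi2 : Integrable (fun x => g y * kernel ν hε (y - x)) ν :=
    (continuous_const.mul hk).integrable_of_hasCompactSupport hks.mul_left
  have hi0 : Integrable (fun x => kernel ν hε (y - x)) ν := hk.integrable_of_hasCompactSupport hks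
  have hi3 : Integrable (fun x => (g x - g y) * kernel ν hε (y - x)) ν := by
    refine (hi1.sub hi2).congr (Eventually.of_forall fun x => ?_)
    simp only [Pi.sub_apply]
    ring
  have h1 : sconv ν g hε y - g y = ∫ x, (g x - g y) * kernel ν hε (y - x) ∂ν := by
    have e : g y = ∫ x, g y * kernel ν hε (y - x) ∂ν := by
      rw [integral_const_mul, integral_kernel_sub, mul_one]
    conv_lhs => rw [sconv, e]
    rw [← integral_sub hi1 hi2]
    simp_rw [sub_mul]
  rw [h1]
  calc |∫ x, (g x - g y) * kernel ν hε (y - x) ∂ν|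
      ≤ ∫ x, |(g x - g y) * kernel ν hε (y - x)| ∂ν := abs_integral_le_integral_abs
    _ ≤ ∫ x, δ * kernel ν hε (y - x) ∂ν := by
        refine integral_mono hi3.abs (hi0.const_mul δ) fun x => ?_
        · simp only
          rw [abs_mul, abs_of_nonneg (kernel_nonneg ν hε _)]
          by_cases hx : dist x y ≤ ε
          · exact mul_le_mul_of_nonneg_right (hδ x hx) (kernel_nonneg ν hε _)
          · have : kernel ν hε (y - x) = 0 := by
              refine kernel_eq_zero ν hε ?_
              rw [← dist_eq_norm, dist_comm]; exact (not_le.1 hx).le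
            simp [this]
    _ = δ := by rw [integral_const_mul, integral_kernel_sub, mul_one]

variable [SFinite μ]

omit [SFinite μ] in
include hθ in
/-- The Fubini integrand `g(x) k_ε(y − x) θ(y)` is integrable on the product. [folklore] -/
theorem integrable_prod_kernel {g : V → ℝ} (hg : Continuous g) (hgs : HasCompactSupport g)
    {ε : ℝ} (hε : 0 < ε) :
    Integrable (fun z : V × V => g z.1 * (kernel ν hε (z.2 - z.1) * θ z.2)) (ν.prod μ) := by
  obtain ⟨M, hM, hk, -⟩ := exists_kernel_bound ν hε
  have hgi : Integrable g ν := hg.integrable_of_hasCompactSupport hgs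
  refine Integrable.mono' (hgi.norm.mul_prod (hθ.norm.const_mul M)) ?_
    (Eventually.of_forall fun z => ?_)
  · exact (hg.comp continuous_fst).aestronglyMeasurable.mul
      ((((continuous_kernel ν hε).comp (continuous_snd.sub continuous_fst)).aestronglyMeasurable).mul
        hθ.1.comp_snd)
  · simp only [norm_mul, Real.norm_eq_abs]
    gcongr
    exact hk _

include hθ in
/-- **Fubini**: `∫ g u_ε dν = ∫ (k_ε ∗ g) θ dμ`. [folklore] -/
theorem integral_mul_moll {g : V → ℝ} (hg : Continuous g) (hgs : HasCompactSupport g)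
    {ε : ℝ} (hε : 0 < ε) :
    ∫ x, g x * moll ν μ θ hε x ∂ν = ∫ y, sconv ν g hε y * θ y ∂μ := by
  have hF := integrable_prod_kernel ν μ hθ hg hgs hε
  calc ∫ x, g x * moll ν μ θ hε x ∂ν
      = ∫ x, ∫ y, g x * (kernel ν hε (y - x) * θ y) ∂μ ∂ν := by
          congr 1 with x
          rw [moll, ← integral_const_mul]
    _ = ∫ y, ∫ x, g x * (kernel ν hε (y - x) * θ y) ∂ν ∂μ :=
          integral_integral_swap hF
    _ = ∫ y, sconv ν g hε y * θ y ∂μ := by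
          congr 1 with y
          rw [sconv, ← integral_mul_const]
          congr 1 with x
          ring

include hθ in
/-- The function `(k_ε ∗ g) θ` is `μ`-integrable. [folklore] -/
theorem integrable_sconv_mul {g : V → ℝ} (hg : Continuous g) (hgs : HasCompactSupport g)
    {ε : ℝ} (hε : 0 < ε) : Integrable (fun y => sconv ν g hε y * θ y) μ := by
  have := (integrable_prod_kernel ν μ hθ hg hgs hε).integral_prod_right
  refine this.congr (Eventually.of_forall fun y => ?_)
  simp only
  rw [sconv, ← integral_mul_const]
  congr 1 with x
  ring

include hθ in
/-- **`∫ (k_ε ∗ g) θ dμ → ∫ g θ dμ`** as `ε → 0`, for continuous compactly supported `g`.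
[folklore] -/
theorem tendsto_integral_sconv_mul {g : V → ℝ} (hg : Continuous g) (hgs : HasCompactSupport g)
    {ε : ℕ → ℝ} (hε : ∀ n, 0 < ε n) (hε0 : Tendsto ε atTop (𝓝 0)) :
    Tendsto (fun n => ∫ y, sconv ν g (hε n) y * θ y ∂μ) atTop (𝓝 (∫ y, g y * θ y ∂μ)) := by
  have hgu : UniformContinuous g := hgs.uniformContinuous_of_continuous hg
  rw [Metric.tendsto_atTop]
  intro δ' hδ'
  set I : ℝ := ∫ y, |θ y| ∂μ with hI
  have hI0 : 0 ≤ I := integral_nonneg fun y => abs_nonneg _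
  set δ : ℝ := δ' / (2 * (I + 1)) with hδdef
  have hδ : 0 < δ := by positivity
  obtain ⟨η, hη, hηδ⟩ := Metric.uniformContinuous_iff.1 hgu δ hδ
  obtain ⟨N, hN⟩ := (Metric.tendsto_atTop.1 hε0) η hη
  refine ⟨N, fun n hn => ?_⟩
  have hεn : ε n < η := by simpa [Real.dist_eq, abs_of_pos (hε n)] using hN n hn
  have hpt : ∀ y, |sconv ν g (hε n) y - g y| ≤ δ := fun y =>
    abs_sconv_sub_le ν hg (hε n) y fun x hx => (hηδ (hx.trans_lt hεn)).le
  have hint := integrable_sconv_mul ν μ hθ hg hgs (hε n)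
  have hint' : Integrable (fun y => g y * θ y) μ := by
    refine Integrable.mono' (hθ.norm.const_mul (⨆ x, ‖g x‖)) (hg.aestronglyMeasurable.mul hθ.1)
      (Eventually.of_forall fun y => ?_)
    rw [norm_mul]
    exact mul_le_mul_of_nonneg_right (le_ciSup (hg.norm.bddAbove_range_of_hasCompactSupport
      hgs.norm) y) (norm_nonneg _)
  rw [Real.dist_eq, ← integral_sub hint hint']
  calc |∫ y, sconv ν g (hε n) y * θ y - g y * θ y ∂μ|
      ≤ ∫ y, |sconv ν g (hε n) y * θ y - g y * θ y| ∂μ := abs_integral_le_integral_abs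
    _ ≤ ∫ y, δ * |θ y| ∂μ := by
        refine integral_mono (hint.sub hint').abs (hθ.abs.const_mul δ) fun y => ?_
        simp only
        rw [← sub_mul, abs_mul]
        exact mul_le_mul_of_nonneg_right (hpt y) (abs_nonneg _)
    _ = δ * I := integral_const_mul _ _
    _ < δ' := by
        rw [hδdef, div_mul_eq_mul_div, div_lt_iff₀ (by positivity)]
        nlinarith

/-! #### The local constant -/

omit [MeasurableSpace V] [BorelSpace V] in
/-- A continuous function supported in a ball has compact support. [folklore] -/
theorem hasCompactSupport_of_support_subset_ball {g : V → ℝ} {x₁ : V} {r : ℝ}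
    (h : support g ⊆ ball x₁ r) : HasCompactSupport g :=
  IsCompact.of_isClosed_subset (isCompact_closedBall x₁ r) isClosed_closure
    ((closure_mono h).trans closure_ball_subset_closedBall)

include hθ in
/-- **Local constancy of the density**: on every ball `B(x₁, r)` with `B̄(x₁, 2r) ⊆ Ω` there is a
constant `c` with `∫ g θ dμ = c ∫ g dν` for all continuous `g` supported in the ball. [folklore] -/
theorem exists_const_ball (H : Hyp μ θ Ω) {x₁ : V} {r : ℝ} (hr : 0 < r)
    (hΩ : closedBall x₁ (2 * r) ⊆ Ω) :
    ∃ c : ℝ, ∀ g : V → ℝ, Continuous g → support g ⊆ ball x₁ r →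
      ∫ y, g y * θ y ∂μ = c * ∫ x, g x ∂ν := by
  set ε : ℕ → ℝ := fun n => r / ((n : ℝ) + 2) with hεdef
  have hε : ∀ n, 0 < ε n := fun n => by positivity
  have hεr : ∀ n, ε n < r := fun n => by
    rw [hεdef]
    exact div_lt_self hr (by linarith [n.cast_nonneg (α := ℝ)])
  have hε0 : Tendsto ε atTop (𝓝 0) := by
    have h := (tendsto_const_div_atTop_nhds_zero_nat r).comp (tendsto_add_atTop_nat 2)
    refine h.congr fun n => ?_
    simp [hεdef, Function.comp]
  have hconst : ∀ n, ∀ x ∈ ball x₁ r, moll ν μ θ (hε n) x = moll ν μ θ (hε n) x₁ := by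
    intro n x hx
    refine moll_eq_moll ν μ hθ H (hε n) ((closedBall_subset_closedBall ?_).trans hΩ) hx
      (mem_ball_self hr)
    linarith [hεr n]
  have hI : ∀ n (g : V → ℝ), Continuous g → support g ⊆ ball x₁ r →
      ∫ y, sconv ν g (hε n) y * θ y ∂μ = moll ν μ θ (hε n) x₁ * ∫ x, g x ∂ν := by
    intro n g hg hsupp
    rw [← integral_mul_moll ν μ hθ hg (hasCompactSupport_of_support_subset_ball hsupp) (hε n),
      ← integral_const_mul]
    congr 1 with x
    by_cases hx : x ∈ support g
    · rw [hconst n x (hsupp hx), mul_comm]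
    · rw [notMem_support.1 hx]; simp
  -- the reference bump
  set b : ContDiffBump x₁ := bump x₁ hr
  set g₀ : V → ℝ := b.normed ν
  have hg₀c : Continuous g₀ := b.continuous_normed
  have hg₀s : support g₀ ⊆ ball x₁ r := b.support_normed_eq.le
  set c : ℝ := ∫ y, g₀ y * θ y ∂μ
  refine ⟨c, fun g hg hsupp => ?_⟩
  have hcn : Tendsto (fun n => moll ν μ θ (hε n) x₁) atTop (𝓝 c) := by
    have h1 := tendsto_integral_sconv_mul ν μ hθ hg₀c b.hasCompactSupport_normed hε hε0
    refine h1.congr fun n => ?_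
    rw [hI n g₀ hg₀c hg₀s, b.integral_normed, mul_one]
  have h2 := tendsto_integral_sconv_mul ν μ hθ hg (hasCompactSupport_of_support_subset_ball hsupp)
    hε hε0
  have h3 : Tendsto (fun n => moll ν μ θ (hε n) x₁ * ∫ x, g x ∂ν) atTop (𝓝 (c * ∫ x, g x ∂ν)) :=
    hcn.mul_const _
  exact tendsto_nhds_unique (h2.congr fun n => hI n g hg hsupp) h3

omit [SFinite μ] in
/-- Two local constants on overlapping balls agree. [folklore] -/
theorem const_unique {x₁ x₂ : V} {r₁ r₂ c₁ c₂ : ℝ}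
    (h₁ : ∀ g : V → ℝ, Continuous g → support g ⊆ ball x₁ r₁ →
      ∫ y, g y * θ y ∂μ = c₁ * ∫ x, g x ∂ν)
    (h₂ : ∀ g : V → ℝ, Continuous g → support g ⊆ ball x₂ r₂ →
      ∫ y, g y * θ y ∂μ = c₂ * ∫ x, g x ∂ν)
    (hne : (ball x₁ r₁ ∩ ball x₂ r₂).Nonempty) : c₁ = c₂ := by
  obtain ⟨z, hz⟩ := hne
  obtain ⟨ρ, hρ, hρsub⟩ := Metric.isOpen_iff.1 (isOpen_ball.inter isOpen_ball) z hz
  set b : ContDiffBump z := bump z hρ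
  have hs : support (b.normed ν) ⊆ ball z ρ := b.support_normed_eq.le
  have e₁ := h₁ _ b.continuous_normed (hs.trans (hρsub.trans inter_subset_left))
  have e₂ := h₂ _ b.continuous_normed (hs.trans (hρsub.trans inter_subset_right))
  rw [b.integral_normed, mul_one] at e₁ e₂
  exact e₁.symm.trans e₂

include hθ in
/-- **A single constant on a connected open set**: there is `c` such that every point of `Ω` has a
ball `B(x, r)`, `B̄(x, 2r) ⊆ Ω`, on which `∫ g θ dμ = c ∫ g dν` for continuous `g` supported in
the ball. [folklore] -/
theorem exists_const_local (H : Hyp μ θ Ω) (hΩo : IsOpen Ω) (hΩc : IsPreconnected Ω) :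
    ∃ c : ℝ, ∀ x ∈ Ω, ∃ r : ℝ, 0 < r ∧ closedBall x (2 * r) ⊆ Ω ∧
      ∀ g : V → ℝ, Continuous g → support g ⊆ ball x r →
        ∫ y, g y * θ y ∂μ = c * ∫ x, g x ∂ν := by
  have hr : ∀ x ∈ Ω, ∃ r : ℝ, 0 < r ∧ closedBall x (2 * r) ⊆ Ω := by
    intro x hx
    obtain ⟨δ, hδ, hδΩ⟩ := Metric.nhds_basis_closedBall.mem_iff.1 (hΩo.mem_nhds hx)
    exact ⟨δ / 2, half_pos hδ, by rwa [mul_div_cancel₀ _ (two_ne_zero' ℝ)]⟩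
  choose! r hr0 hrΩ using hr
  have hc : ∀ x ∈ Ω, ∃ c : ℝ, ∀ g : V → ℝ, Continuous g → support g ⊆ ball x (r x) →
      ∫ y, g y * θ y ∂μ = c * ∫ x, g x ∂ν := fun x hx =>
    exists_const_ball ν μ hθ H (hr0 x hx) (hrΩ x hx)
  choose! c hc using hc
  have hballΩ : ∀ x ∈ Ω, ball x (r x) ⊆ Ω := fun x hx =>
    (ball_subset_closedBall.trans (closedBall_subset_closedBall (by linarith [hr0 x hx]))).trans
      (hrΩ x hx)
  have hloc : ∀ x ∈ Ω, ∀ x' ∈ ball x (r x), c x' = c x := fun x hx x' hx' => by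
    have hx'Ω : x' ∈ Ω := hballΩ x hx hx'
    exact const_unique ν μ (hc x' hx'Ω) (hc x hx) ⟨x', mem_ball_self (hr0 x' hx'Ω), hx'⟩
  rcases Ω.eq_empty_or_nonempty with h | ⟨x₀, hx₀⟩
  · exact ⟨0, by simp [h]⟩
  refine ⟨c x₀, fun x hx => ⟨r x, hr0 x hx, hrΩ x hx, ?_⟩⟩
  have : c x = c x₀ := by
    refine hΩc.induction₂' (fun a b => c a = c b) (fun a ha => ?_)
      (fun _ _ _ _ _ _ h1 h2 => h1.trans h2) hx hx₀
    filter_upwards [mem_nhdsWithin_of_mem_nhds (ball_mem_nhds a (hr0 a ha))] with b hb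
    exact ⟨(hloc a ha b hb).symm, hloc a ha b hb⟩
  rw [← this]
  exact hc x hx

/-! #### From test functions to sets -/

omit [NormedSpace ℝ V] [FiniteDimensional ℝ V] [MeasurableSpace V] [BorelSpace V] in
/-- Continuous approximants `0 ≤ gₙ ≤ 1` of the indicator of an open set, supported in it and
converging pointwise. [folklore] -/
theorem exists_seq_tendsto_indicator {W : Set V} (hW : IsOpen W) :
    ∃ g : ℕ → V → ℝ, (∀ n, Continuous (g n)) ∧ (∀ n, support (g n) ⊆ W) ∧ (∀ n x, 0 ≤ g n x) ∧
      (∀ n x, g n x ≤ 1) ∧ ∀ x, Tendsto (fun n => g n x) atTop (𝓝 (W.indicator 1 x)) := by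
  by_cases hWc : Wᶜ.Nonempty
  · refine ⟨fun n x => min 1 (n * infDist x Wᶜ), fun n => ?_, fun n => ?_, fun n x => ?_,
      fun n x => min_le_left _ _, fun x => ?_⟩
    · exact continuous_const.min (continuous_const.mul (continuous_infDist_pt Wᶜ))
    · intro x hx
      rw [mem_support] at hx
      by_contra hxW
      have : infDist x Wᶜ = 0 := infDist_zero_of_mem hxW
      simp [this] at hx
    · exact le_min zero_le_one (mul_nonneg n.cast_nonneg infDist_nonneg)
    · by_cases hx : x ∈ W
      · have hpos : 0 < infDist x Wᶜ :=
          (hW.isClosed_compl.notMem_iff_infDist_pos hWc).1 fun h => h hx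
        simp only [indicator_of_mem hx, Pi.one_apply]
        refine tendsto_atTop_of_eventually_const (i₀ := ⌈(infDist x Wᶜ)⁻¹⌉₊) fun n hn => ?_
        rw [min_eq_left]
        have h1 : (infDist x Wᶜ)⁻¹ ≤ n := (Nat.le_ceil _).trans (by exact_mod_cast hn)
        calc (1 : ℝ) = (infDist x Wᶜ)⁻¹ * infDist x Wᶜ := by field_simp
          _ ≤ n * infDist x Wᶜ := mul_le_mul_of_nonneg_right h1 infDist_nonneg
      · have : infDist x Wᶜ = 0 := infDist_zero_of_mem hx
        simp [indicator_of_notMem hx, this]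
  · have hW' : W = univ := by
      rwa [not_nonempty_iff_eq_empty, compl_empty_iff] at hWc
    exact ⟨fun _ _ => 1, fun _ => continuous_const, fun n => by simp [hW'], fun _ _ => zero_le_one,
      fun _ _ => le_rfl, fun x => by simp [hW']⟩

omit [SFinite μ] in
include hθ in
/-- **The identity on open subsets of the ball**: `∫_W θ dμ = c ν(W)`. [folklore] -/
theorem setIntegral_eq_of_isOpen {x₁ : V} {r c : ℝ}
    (hB : ∀ g : V → ℝ, Continuous g → support g ⊆ ball x₁ r →
      ∫ y, g y * θ y ∂μ = c * ∫ x, g x ∂ν)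
    {W : Set V} (hW : IsOpen W) (hWB : W ⊆ ball x₁ r) :
    ∫ y in W, θ y ∂μ = c * (ν W).toReal := by
  obtain ⟨g, hgc, hgs, hg0, hg1, hgt⟩ := exists_seq_tendsto_indicator hW
  have h1 : Tendsto (fun n => ∫ y, g n y * θ y ∂μ) atTop (𝓝 (∫ y in W, θ y ∂μ)) := by
    rw [← integral_indicator hW.measurableSet]
    refine tendsto_integral_of_dominated_convergence (fun y => |θ y|)
      (fun n => (hgc n).aestronglyMeasurable.mul hθ.1) hθ.abs (fun n => ae_of_all _ fun y => ?_)
      (ae_of_all _ fun y => ?_)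
    · rw [Real.norm_eq_abs, abs_mul, abs_of_nonneg (hg0 n y)]
      exact mul_le_of_le_one_left (abs_nonneg _) (hg1 n y)
    · have := (hgt y).mul_const (θ y)
      refine this.congr' (Eventually.of_forall fun n => rfl) |>.trans ?_
      by_cases hy : y ∈ W <;> simp [hy]
  have h2 : Tendsto (fun n => ∫ x, g n x ∂ν) atTop (𝓝 (ν W).toReal) := by
    have e : (ν W).toReal = ∫ x, W.indicator (1 : V → ℝ) x ∂ν := by
      rw [integral_indicator_one hW.measurableSet, measureReal_def]
    rw [e]
    refine tendsto_integral_of_dominated_convergence ((ball x₁ r).indicator 1)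
      (fun n => (hgc n).aestronglyMeasurable) ?_ (fun n => ae_of_all _ fun y => ?_)
      (ae_of_all _ fun y => hgt y)
    · exact (integrable_indicator_iff measurableSet_ball).2
        (integrableOn_const (measure_ball_lt_top (x := x₁) (r := r)).ne)
    · by_cases hy : y ∈ ball x₁ r
      · rw [indicator_of_mem hy, Pi.one_apply, Real.norm_eq_abs, abs_of_nonneg (hg0 n y)]
        exact hg1 n y
      · have : g n y = 0 := by
          by_contra h
          exact hy (hgs n (mem_support.2 h) |> hWB)
        rw [this, norm_zero]
        exact indicator_nonneg (fun _ _ => zero_le_one) y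
  have h4 : Tendsto (fun n => c * ∫ x, g n x ∂ν) atTop (𝓝 (c * (ν W).toReal)) := h2.const_mul c
  exact tendsto_nhds_unique (h1.congr fun n => hB (g n) (hgc n) ((hgs n).trans hWB)) h4

/-- Bookkeeping: with `P = ∫⁻_S θ⁺ dμ`, `M = ∫⁻_S θ⁻ dμ`, `N = ν S` all finite,
`P + c⁻ N = M + c⁺ N ↔ ∫_S θ dμ = c N`. [folklore] -/
theorem ennreal_bookkeeping {P M N : ℝ≥0∞} (hP : P ≠ ⊤) (hM : M ≠ ⊤) (hN : N ≠ ⊤) {I c : ℝ}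
    (hI : I = P.toReal - M.toReal) :
    P + ENNReal.ofReal (-c) * N = M + ENNReal.ofReal c * N ↔ I = c * N.toReal := by
  have h1 : P + ENNReal.ofReal (-c) * N ≠ ⊤ :=
    ENNReal.add_ne_top.2 ⟨hP, ENNReal.mul_ne_top ENNReal.ofReal_ne_top hN⟩
  have h2 : M + ENNReal.ofReal c * N ≠ ⊤ :=
    ENNReal.add_ne_top.2 ⟨hM, ENNReal.mul_ne_top ENNReal.ofReal_ne_top hN⟩
  rw [← ENNReal.toReal_eq_toReal_iff' h1 h2, ENNReal.toReal_add hP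
    (ENNReal.mul_ne_top ENNReal.ofReal_ne_top hN), ENNReal.toReal_add hM
    (ENNReal.mul_ne_top ENNReal.ofReal_ne_top hN), ENNReal.toReal_mul, ENNReal.toReal_mul, hI]
  have hc : (ENNReal.ofReal c).toReal - (ENNReal.ofReal (-c)).toReal = c := by
    rcases le_total 0 c with h | h
    · rw [ENNReal.toReal_ofReal h, ENNReal.ofReal_of_nonpos (by linarith), ENNReal.toReal_zero,
        sub_zero]
    · rw [ENNReal.toReal_ofReal (by linarith : 0 ≤ -c), ENNReal.ofReal_of_nonpos h,
        ENNReal.toReal_zero, zero_sub, neg_neg]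
  constructor
  · intro h
    rw [← hc]
    linarith
  · intro h
    rw [← hc] at h
    linarith


omit [SFinite μ] in
include hθ in
/-- **The identity on measurable subsets of the ball**: `∫_A θ dμ = c ν(A)` for every measurable
`A ⊆ B(x₁, r)` (two finite measures agreeing on the open subsets of the ball coincide).
[folklore] -/
theorem setIntegral_eq_of_subset_ball {x₁ : V} {r c : ℝ}
    (hB : ∀ g : V → ℝ, Continuous g → support g ⊆ ball x₁ r →
      ∫ y, g y * θ y ∂μ = c * ∫ x, g x ∂ν)
    {A : Set V} (hA : MeasurableSet A) (hAB : A ⊆ ball x₁ r) :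
    ∫ y in A, θ y ∂μ = c * (ν A).toReal := by
  set B : Set V := ball x₁ r with hBdef
  have hBm : MeasurableSet B := measurableSet_ball
  have hνB : ν B ≠ ⊤ := measure_ball_lt_top.ne
  set α : Measure V := (μ.withDensity fun y => ENNReal.ofReal (θ y)).restrict B +
    ENNReal.ofReal (-c) • ν.restrict B with hαdef
  set β : Measure V := (μ.withDensity fun y => ENNReal.ofReal (-θ y)).restrict B +
    ENNReal.ofReal c • ν.restrict B with hβdef
  have hPfin : ∀ S, ∫⁻ y in S, ENNReal.ofReal (θ y) ∂μ ≠ ⊤ := fun S => by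
    refine ((setLIntegral_le_lintegral S _).trans_lt
      ((lintegral_mono fun y => ?_).trans_lt hθ.2)).ne
    rw [Real.enorm_eq_ofReal_abs]
    exact ENNReal.ofReal_le_ofReal (le_abs_self _)
  have hMfin : ∀ S, ∫⁻ y in S, ENNReal.ofReal (-θ y) ∂μ ≠ ⊤ := fun S => by
    refine ((setLIntegral_le_lintegral S _).trans_lt
      ((lintegral_mono fun y => ?_).trans_lt hθ.2)).ne
    rw [Real.enorm_eq_ofReal_abs]
    exact ENNReal.ofReal_le_ofReal (neg_le_abs _)
  have hαS : ∀ S, MeasurableSet S → α S =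
      ∫⁻ y in S ∩ B, ENNReal.ofReal (θ y) ∂μ + ENNReal.ofReal (-c) * ν (S ∩ B) := fun S hS => by
    simp only [hαdef, Measure.add_apply, Measure.smul_apply, Measure.restrict_apply hS,
      withDensity_apply _ (hS.inter hBm), smul_eq_mul]
  have hβS : ∀ S, MeasurableSet S → β S =
      ∫⁻ y in S ∩ B, ENNReal.ofReal (-θ y) ∂μ + ENNReal.ofReal c * ν (S ∩ B) := fun S hS => by
    simp only [hβdef, Measure.add_apply, Measure.smul_apply, Measure.restrict_apply hS,
      withDensity_apply _ (hS.inter hBm), smul_eq_mul]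
  have hI : ∀ S, ∫ y in S, θ y ∂μ = (∫⁻ y in S, ENNReal.ofReal (θ y) ∂μ).toReal -
      (∫⁻ y in S, ENNReal.ofReal (-θ y) ∂μ).toReal := fun S =>
    integral_eq_lintegral_pos_part_sub_lintegral_neg_part hθ.integrableOn
  have key : ∀ S, MeasurableSet S → S ⊆ B →
      (α S = β S ↔ ∫ y in S, θ y ∂μ = c * (ν S).toReal) := fun S hS hSB => by
    rw [hαS S hS, hβS S hS, inter_eq_left.2 hSB]
    exact ennreal_bookkeeping (hPfin S) (hMfin S)
      ((measure_mono hSB).trans_lt measure_ball_lt_top).ne (hI S)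
  have hαβ : α = β := by
    refine Measure.ext_of_isOpen_subset ⟨B, isOpen_ball⟩ ?_ ?_ (fun K hK _ => ?_)
      (fun U hU hUB => ?_)
    · show α Bᶜ = 0
      rw [hαS _ hBm.compl]; simp
    · show β Bᶜ = 0
      rw [hβS _ hBm.compl]; simp
    · rw [hβS _ hK.measurableSet]
      exact ENNReal.add_ne_top.2 ⟨hMfin _, ENNReal.mul_ne_top ENNReal.ofReal_ne_top
        ((measure_mono inter_subset_right).trans_lt measure_ball_lt_top).ne⟩
    · exact (key U hU.measurableSet hUB).2 (setIntegral_eq_of_isOpen ν μ hθ hB hU hUB)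
  exact (key A hA hAB).1 (by rw [hαβ])

include hθ in
/-- **Zero distributional gradient on a connected open set forces a constant density**: if
`∫ (D_v g) θ dμ = 0` for all smooth `g` compactly supported in the connected open set `Ω` and all
directions `v`, then there is a constant `c` with `∫_A θ dμ = c · ν(A)` for every measurable
`A ⊆ Ω` of finite Haar measure (the distribution `θ μ` is the constant `c` on `Ω`; proof by
mollification). [folklore] -/
theorem exists_const (H : Hyp μ θ Ω) (hΩo : IsOpen Ω) (hΩc : IsPreconnected Ω) :
    ∃ c : ℝ, ∀ A : Set V, MeasurableSet A → A ⊆ Ω → ν A ≠ ⊤ →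
      ∫ y in A, θ y ∂μ = c * (ν A).toReal := by
  obtain ⟨c, hc⟩ := exists_const_local ν μ hθ H hΩo hΩc
  choose! r hr0 hrΩ hB using hc
  refine ⟨c, fun A hA hAΩ hνA => ?_⟩
  have hball : ∀ x ∈ Ω, ∀ S, MeasurableSet S → S ⊆ ball x (r x) →
      ∫ y in S, θ y ∂μ = c * (ν S).toReal := fun x hx S hS hSB =>
    setIntegral_eq_of_subset_ball ν μ hθ (hB x hx) hS hSB
  obtain ⟨t, htΩ, htc, hcover⟩ := TopologicalSpace.countable_cover_nhdsWithin
    (f := fun x => ball x (r x)) (s := Ω) fun x hx =>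
      mem_nhdsWithin_of_mem_nhds (ball_mem_nhds x (hr0 x hx))
  rcases t.eq_empty_or_nonempty with ht | ht
  · have hA0 : A = ∅ := by
      rw [ht] at hcover
      simp only [mem_empty_iff_false, iUnion_of_empty, iUnion_empty] at hcover
      exact subset_eq_empty (hAΩ.trans hcover) rfl
    simp [hA0]
  obtain ⟨x, hx⟩ := htc.exists_eq_range ht
  have hxΩ : ∀ n, x n ∈ Ω := fun n => htΩ (hx ▸ mem_range_self n)
  set D : ℕ → Set V := disjointed fun n => ball (x n) (r (x n)) with hDdef
  have hDm : ∀ n, MeasurableSet (D n) :=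
    MeasurableSet.disjointed fun n => measurableSet_ball
  have hDsub : ∀ n, D n ⊆ ball (x n) (r (x n)) := fun n => disjointed_subset _ n
  have hDdisj : Pairwise (Disjoint on D) := disjoint_disjointed _
  have hAcover : A = ⋃ n, A ∩ D n := by
    rw [← inter_iUnion, hDdef, iUnion_disjointed]
    refine (inter_eq_left.2 (hAΩ.trans ?_)).symm
    intro y hy
    have := hcover hy
    rw [hx, biUnion_range] at this
    exact this
  have hmA : ∀ n, MeasurableSet (A ∩ D n) := fun n => hA.inter (hDm n)
  have hdisjA : Pairwise (Disjoint on fun n => A ∩ D n) := fun i j hij =>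
    (hDdisj hij).mono inter_subset_right inter_subset_right
  have hpieces : ∀ n, ∫ y in A ∩ D n, θ y ∂μ = c * (ν (A ∩ D n)).toReal := fun n =>
    hball (x n) (hxΩ n) _ (hmA n) (inter_subset_right.trans (hDsub n))
  have hνsum : ν A = ∑' n, ν (A ∩ D n) := by
    conv_lhs => rw [hAcover]
    exact measure_iUnion hdisjA hmA
  have hfin : ∀ n, ν (A ∩ D n) ≠ ⊤ := fun n =>
    ((measure_mono inter_subset_left).trans_lt hνA.lt_top).ne
  calc ∫ y in A, θ y ∂μ = ∫ y in ⋃ n, A ∩ D n, θ y ∂μ := by rw [← hAcover]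
    _ = ∑' n, ∫ y in A ∩ D n, θ y ∂μ := integral_iUnion hmA hdisjA hθ.integrableOn
    _ = ∑' n, c * (ν (A ∩ D n)).toReal := tsum_congr hpieces
    _ = c * ∑' n, (ν (A ∩ D n)).toReal := tsum_mul_left
    _ = c * (ν A).toReal := by rw [hνsum, ENNReal.tsum_toReal_eq hfin]

/-! ### Transfer to an affine plane of an inner product space -/

section Plane

variable {V : Type*} [NormedAddCommGroup V] [InnerProductSpace ℝ V] [FiniteDimensional ℝ V]
  [MeasurableSpace V] [BorelSpace V]

/-- The affine isometric embedding `y ↦ p₀ + y` of the direction space `P₀` onto the affine plane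
`p₀ + P₀`. [folklore] -/
def planeEmb (P₀ : Submodule ℝ V) (p₀ : V) : P₀ → V := fun y => p₀ + (y : V)

/-- The affine orthogonal projection `x ↦ π_{P₀}(x − p₀)` onto the direction space. [folklore] -/
def planeProj (P₀ : Submodule ℝ V) (p₀ : V) : V → P₀ := fun x => P₀.orthogonalProjectionOnto (x - p₀)

variable (P₀ : Submodule ℝ V) (p₀ : V)

omit [FiniteDimensional ℝ V] [MeasurableSpace V] [BorelSpace V] in
/-- `y ↦ p₀ + y` is an isometry. [folklore] -/
theorem isometry_planeEmb : Isometry (planeEmb P₀ p₀) := by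
  refine Isometry.of_dist_eq fun y y' => ?_
  simp only [planeEmb, dist_add_left, Subtype.dist_eq]

omit [FiniteDimensional ℝ V] [MeasurableSpace V] [BorelSpace V] in
/-- `y ↦ p₀ + y` is continuous. [folklore] -/
theorem continuous_planeEmb : Continuous (planeEmb P₀ p₀) :=
  (isometry_planeEmb P₀ p₀).continuous

omit [MeasurableSpace V] [BorelSpace V] in
/-- `x ↦ π_{P₀}(x - p₀)` is smooth. [folklore] -/
theorem contDiff_planeProj : ContDiff ℝ ∞ (planeProj P₀ p₀) :=
  P₀.orthogonalProjectionOnto.contDiff.comp (contDiff_id.sub contDiff_const)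

omit [MeasurableSpace V] [BorelSpace V] in
/-- `x ↦ π_{P₀}(x - p₀)` is continuous. [folklore] -/
theorem continuous_planeProj : Continuous (planeProj P₀ p₀) :=
  (contDiff_planeProj P₀ p₀).continuous

omit [MeasurableSpace V] [BorelSpace V] in
/-- The differential of `x ↦ π_{P₀}(x - p₀)` is the orthogonal projection. [folklore] -/
theorem hasFDerivAt_planeProj (x : V) :
    HasFDerivAt (planeProj P₀ p₀) (P₀.orthogonalProjectionOnto : V →L[ℝ] P₀) x := by
  have h := (P₀.orthogonalProjectionOnto.hasFDerivAt).comp x ((hasFDerivAt_id x).sub_const p₀)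
  rwa [ContinuousLinearMap.comp_id] at h

omit [MeasurableSpace V] [BorelSpace V] in
/-- `π(ι y) = y`. [folklore] -/
@[simp] theorem planeProj_planeEmb (y : P₀) : planeProj P₀ p₀ (planeEmb P₀ p₀ y) = y := by
  simp [planeProj, planeEmb]

omit [MeasurableSpace V] [BorelSpace V] in
/-- `ι(π x) = x` on the plane. [folklore] -/
theorem planeEmb_planeProj {x : V} (hx : x - p₀ ∈ P₀) : planeEmb P₀ p₀ (planeProj P₀ p₀ x) = x := by
  simp only [planeEmb, planeProj]
  rw [Submodule.coe_orthogonalProjectionOnto_apply, Submodule.starProjection_eq_self_iff.2 hx]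
  abel

omit [FiniteDimensional ℝ V] [MeasurableSpace V] [BorelSpace V] in
/-- The range of `ι` is the affine plane `p₀ + P₀`. [folklore] -/
theorem range_planeEmb : range (planeEmb P₀ p₀) = {x | x - p₀ ∈ P₀} := by
  ext x
  constructor
  · rintro ⟨y, rfl⟩
    simp [planeEmb]
  · intro hx
    exact ⟨⟨x - p₀, hx⟩, by simp [planeEmb]⟩

omit [FiniteDimensional ℝ V] [MeasurableSpace V] [BorelSpace V] in
/-- `ι y` lies on the plane. [folklore] -/
theorem planeEmb_mem (y : P₀) : planeEmb P₀ p₀ y - p₀ ∈ P₀ := by simp [planeEmb]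

omit [MeasurableSpace V] [BorelSpace V] in
/-- The affine plane `p₀ + P₀` is closed. [folklore] -/
theorem isClosed_plane : IsClosed {x : V | x - p₀ ∈ P₀} := by
  rw [← range_planeEmb]
  exact (isometry_planeEmb P₀ p₀).isClosedEmbedding.isClosed_range

variable {P₀ p₀}

/-- **Zero tangential gradient along an affine plane forces a constant density w.r.t. `𝓗ᵐ`**
(transfer of `ZeroGradient.exists_const` to the plane `p₀ + P₀` through the isometry
`y ↦ p₀ + y`): for a finite measure `μ` concentrated on the plane and `θ ∈ L¹(μ)` with
`∫ (D_v g) θ dμ = 0` for all smooth `g` compactly supported in the open set `U` and all directions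
`v ∈ P₀`, `U ∩ (p₀ + P₀)` being connected, there is `c` with
`∫_A θ dμ = c 𝓗ᵐ(A ∩ (p₀ + P₀))` for all Borel `A ⊆ U` (`m = dim P₀`, `𝓗ᵐ = μHE[m]`).
[folklore] -/
theorem exists_const_plane (μ : Measure V) [IsFiniteMeasure μ] {θ : V → ℝ} (hθ : Integrable θ μ)
    (hμ : μ {x | x - p₀ ∈ P₀}ᶜ = 0) {U : Set V} (hUo : IsOpen U)
    (hUc : IsPreconnected (planeEmb P₀ p₀ ⁻¹' U))
    (H : ∀ g : V → ℝ, ContDiff ℝ ∞ g → HasCompactSupport g → tsupport g ⊆ U →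
      ∀ v ∈ P₀, ∫ x, fderiv ℝ g x v * θ x ∂μ = 0) :
    ∃ c : ℝ, ∀ A : Set V, MeasurableSet A → A ⊆ U →
      μHE[Module.finrank ℝ P₀] (A ∩ {x | x - p₀ ∈ P₀}) ≠ ⊤ →
      ∫ x in A, θ x ∂μ = c * (μHE[Module.finrank ℝ P₀] (A ∩ {x | x - p₀ ∈ P₀})).toReal := by
  -- Step 0: replace `θ` by a strongly measurable version
  wlog hθm : StronglyMeasurable θ generalizing θ
  · have hθ' : Integrable (hθ.1.mk θ) μ := hθ.congr hθ.1.ae_eq_mk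
    have H' : ∀ g : V → ℝ, ContDiff ℝ ∞ g → HasCompactSupport g → tsupport g ⊆ U →
        ∀ v ∈ P₀, ∫ x, fderiv ℝ g x v * hθ.1.mk θ x ∂μ = 0 := by
      intro g hg hgc hgU v hv
      rw [← H g hg hgc hgU v hv]
      refine integral_congr_ae ?_
      filter_upwards [hθ.1.ae_eq_mk] with x hx
      rw [hx]
    obtain ⟨c, hc⟩ := this hθ' H' hθ.1.stronglyMeasurable_mk
    refine ⟨c, fun A hA hAU hfin => ?_⟩
    rw [← hc A hA hAU hfin]
    refine setIntegral_congr_ae hA ?_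
    filter_upwards [hθ.1.ae_eq_mk] with x hx _
    exact hx
  set ι := planeEmb P₀ p₀ with hιdef
  set π := planeProj P₀ p₀ with hπdef
  set d := Module.finrank ℝ P₀
  set ν : Measure P₀ := μHE[d] with hνdef
  set μ' : Measure P₀ := μ.map π with hμ'def
  set θ' : P₀ → ℝ := θ ∘ ι with hθ'def
  have hπm : Measurable π := (continuous_planeProj P₀ p₀).measurable
  have hιm : Measurable ι := (continuous_planeEmb P₀ p₀).measurable
  have hplane : ∀ᵐ x ∂μ, x - p₀ ∈ P₀ := by
    rw [ae_iff]
    exact hμ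
  have hιπ : ∀ᵐ x ∂μ, ι (π x) = x := hplane.mono fun x hx => planeEmb_planeProj P₀ p₀ hx
  have hθ'm : StronglyMeasurable θ' := (hθm.measurable.comp hιm).stronglyMeasurable
  have hθ' : Integrable θ' μ' := by
    rw [hμ'def, integrable_map_measure hθ'm.aestronglyMeasurable hπm.aemeasurable]
    refine hθ.congr ?_
    filter_upwards [hιπ] with x hx
    simp [hθ'def, hx]
  -- Step 1: the zero-gradient hypothesis on `P₀`
  have H' : Hyp μ' θ' (ι ⁻¹' U) := by
    intro h hh hhc hhU v
    -- the compact `K = ι(tsupport h) ⊆ U` and a cutoff `χ = 1` near `K`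
    have hK : IsCompact (ι '' tsupport h) := hhc.image (continuous_planeEmb P₀ p₀)
    have hKU : ι '' tsupport h ⊆ U := image_subset_iff.2 hhU
    obtain ⟨χ, W, hW, hKW, hχ1, -⟩ :=
      exists_testFunction_eq_one_nhds (Ω := ⟨U, hUo⟩) hK hKU
    set g : V → ℝ := fun x => χ x * h (π x) with hgdef
    have hgs : ContDiff ℝ ∞ g := χ.contDiff.mul (hh.comp (contDiff_planeProj P₀ p₀))
    have hgc : HasCompactSupport g := χ.hasCompactSupport.mul_right
    have hgU : tsupport g ⊆ U :=
      (tsupport_mul_subset_left (f := (χ : V → ℝ)) (g := fun x => h (π x))).trans χ.tsupport_subset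
    have h0 := H g hgs hgc hgU v v.2
    -- pointwise on the plane: `D g(x)(v) = D h(π x)(v)`
    have hpt : ∀ x, x - p₀ ∈ P₀ → fderiv ℝ g x v = fderiv ℝ h (π x) v := by
      intro x hx
      have hcomp : fderiv ℝ (fun y => h (π y)) x v = fderiv ℝ h (π x) v := by
        have hd : HasFDerivAt (fun y => h (π y))
            ((fderiv ℝ h (π x)).comp (P₀.orthogonalProjectionOnto : V →L[ℝ] P₀)) x :=
          ((hh.differentiable (by simp)) (π x)).hasFDerivAt.comp x
            (hasFDerivAt_planeProj P₀ p₀ x)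
        rw [hd.fderiv, ContinuousLinearMap.comp_apply,
          Submodule.orthogonalProjectionOnto_mem_subspace_eq_self]
      by_cases hxs : π x ∈ tsupport h
      · -- near `x ∈ K ⊆ W` the cutoff is `1`
        have hxK : x ∈ W := hKW ⟨π x, hxs, planeEmb_planeProj P₀ p₀ hx⟩
        have heq : g =ᶠ[𝓝 x] fun y => h (π y) := by
          filter_upwards [hW.mem_nhds hxK] with y hy
          simp [hgdef, hχ1 y hy]
        rw [heq.fderiv_eq, hcomp]
      · -- off `π⁻¹(tsupport h)` both sides vanish
        have hopen : IsOpen (π ⁻¹' (tsupport h)ᶜ) :=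
          (isClosed_tsupport h).isOpen_compl.preimage (continuous_planeProj P₀ p₀)
        have heq : g =ᶠ[𝓝 x] fun _ => 0 := by
          filter_upwards [hopen.mem_nhds hxs] with y hy
          simp [hgdef, image_eq_zero_of_notMem_tsupport hy]
        have heq' : h =ᶠ[𝓝 (π x)] fun _ => 0 := by
          filter_upwards [(isClosed_tsupport h).isOpen_compl.mem_nhds hxs] with z hz
          exact image_eq_zero_of_notMem_tsupport hz
        rw [heq.fderiv_eq, heq'.fderiv_eq]
        simp
    -- rewrite the integral over `μ' = π_* μ`
    have hF : AEStronglyMeasurable (fun y => fderiv ℝ h y v * θ' y) μ' :=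
      (((hh.continuous_fderiv (by simp)).clm_apply continuous_const).aestronglyMeasurable).mul
        hθ'm.aestronglyMeasurable
    rw [hμ'def, integral_map hπm.aemeasurable hF, ← h0]
    refine integral_congr_ae ?_
    filter_upwards [hplane, hιπ] with x hx hx'
    simp [hθ'def, hx', hpt x hx]
  -- Step 2: the flat case on `P₀`
  obtain ⟨c, hc⟩ := exists_const ν μ' hθ' H' (hUo.preimage (continuous_planeEmb P₀ p₀)) hUc
  refine ⟨c, fun A hA hAU hfin => ?_⟩
  have hrange : range ι = {x | x - p₀ ∈ P₀} := range_planeEmb P₀ p₀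
  have hνA : ν (ι ⁻¹' A) = μHE[d] (A ∩ {x | x - p₀ ∈ P₀}) := by
    rw [hνdef, (isometry_planeEmb P₀ p₀).euclideanHausdorffMeasure_preimage, hrange]
  have h1 := hc (ι ⁻¹' A) (hιm hA) (preimage_mono hAU) (by rwa [hνA])
  rw [hνA] at h1
  rw [← h1]
  -- `∫_{ι⁻¹ A} θ' dμ' = ∫_A θ dμ`
  have hres : μ'.restrict (ι ⁻¹' A) = (μ.restrict A).map π := by
    rw [hμ'def, Measure.restrict_map hπm (hιm hA)]
    congr 1
    refine Measure.restrict_congr_set ?_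
    refine (ae_eq_set).2 ⟨?_, ?_⟩ <;>
    · rw [ae_iff] at hιπ
      refine measure_mono_null (fun x hx => ?_) hιπ
      intro hx'
      simp only [Set.mem_sdiff, mem_preimage] at hx
      rw [hx'] at hx
      tauto
  rw [hres, integral_map hπm.aemeasurable hθ'm.aestronglyMeasurable]
  refine integral_congr_ae ?_
  filter_upwards [ae_restrict_of_ae (s := A) hιπ] with x hx
  simp [hθ'def, hx]

end Plane

end ZeroGradient

/-! ### The constancy theorem for rectifiable currents on an open face of a plane -/

section Currents

open ZeroGradient

-- Nested operator-norm instances on (duals of) `V [⋀^Fin m]→L[ℝ] ℝ`.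
set_option maxSynthPendingDepth 2

open scoped InnerProductSpace

variable {V : Type*} [NormedAddCommGroup V] [InnerProductSpace ℝ V] [FiniteDimensional ℝ V]
  [MeasurableSpace V] [BorelSpace V]

/-- **`‖T‖(Ω ∖ spt T) = 0`**: the variation measure lives on the support. [cite: Federer1969, 4.1.7] -/
theorem Current.variation_sdiff_support {Ω : Opens V} {m : ℕ} (T : Current Ω m) :
    T.variation ((Ω : Set V) \ T.support) = 0 := by
  rw [T.variation_apply_of_isOpen T.isOpen_sdiff_support, Current.variationOn]
  refine le_antisymm (iSup_le fun φ => iSup_le fun _ => iSup_le fun hφ => ?_) bot_le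
  rw [T.apply_eq_zero_of_disjoint_support, ENNReal.ofReal_zero]
  exact Set.disjoint_left.2 fun x hx hxs => (hφ hx).2 hxs

omit [MeasurableSpace V] [BorelSpace V] in
/-- **Tangent vectors of an affine plane lie in its direction**: `Tan(p₀ + P₀, x) ⊆ P₀` at every
point `x` of the plane. [folklore] -/
theorem posTangentConeAt_plane_subset (P₀ : Submodule ℝ V) (p₀ : V) {x : V} (hx : x - p₀ ∈ P₀) :
    posTangentConeAt {y : V | y - p₀ ∈ P₀} x ⊆ (P₀ : Set V) := by
  intro y hy
  rw [posTangentConeAt, mem_tangentConeAt_iff_exists_seq] at hy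
  obtain ⟨c, d, -, hds, hcd⟩ := hy
  have hmem : ∀ᶠ n in atTop, c n • d n ∈ (P₀ : Set V) := by
    filter_upwards [hds] with n hn
    have : d n ∈ P₀ := by
      have h1 : x + d n - p₀ - (x - p₀) = d n := by abel
      rw [← h1]
      exact P₀.sub_mem hn hx
    rw [NNReal.smul_def]
    exact P₀.smul_mem _ this
  exact (Submodule.closed_of_finiteDimensional P₀).mem_of_tendsto hcd hmem

/-- **Approximate tangent vectors of a subset of a plane lie in its direction**:
`Tan^m(𝓗ᵐ ⌞ W, x) ⊆ P₀` for `W ⊆ p₀ + P₀` Borel and `x` on the plane. [cite: Federer1969, 3.2.16] -/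
theorem approxTangentCone_subset_of_subset_plane {m : ℕ} (P₀ : Submodule ℝ V) (p₀ : V)
    {W : Set V} (hWm : MeasurableSet W) (hW : W ⊆ {y | y - p₀ ∈ P₀}) {x : V}
    (hx : x - p₀ ∈ P₀) :
    approxTangentCone m ((μHE[m] : Measure V).restrict W) x ⊆ (P₀ : Set V) :=
  calc approxTangentCone m ((μHE[m] : Measure V).restrict W) x ⊆ posTangentConeAt (W ∩ univ) x :=
        approxTangentCone_restrict_subset_posTangentConeAt _ hWm MeasurableSet.univ univ_mem
    _ ⊆ posTangentConeAt {y | y - p₀ ∈ P₀} x := by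
        rw [inter_univ]; exact tangentConeAt_mono hW
    _ ⊆ (P₀ : Set V) := posTangentConeAt_plane_subset P₀ p₀ hx

/-- **Frame alignment on a plane**: for admissible data `(W, θ, ξ)` carried by the affine
`k`-plane `p₀ + P₀` and an orthonormal `k`-frame `e` of `P₀`, `ξ₁ ∧ ⋯ ∧ ξ_k = ± e₁ ∧ ⋯ ∧ e_k`
at `𝓗ᵏ ⌞ W`-a.e. point ("Tan^m … is associated with η(x)"). [cite: Federer1969, 4.1.28 (4), 4.1.31] -/
theorem IsRectifiableData.ae_frameVector_eq_or {k : ℕ} {Ω : Opens V} {W : Set V} {θ : V → ℤ}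
    {ξ : V → Fin k → V} (h : IsRectifiableData Ω k W θ ξ) (P₀ : Submodule ℝ V) (p₀ : V)
    (hW : W ⊆ {y | y - p₀ ∈ P₀}) (hP₀ : Module.finrank ℝ P₀ = k) {e : Fin k → V}
    (he : Orthonormal ℝ e) (heP : ∀ i, e i ∈ P₀) :
    ∀ᵐ x ∂((μHE[k] : Measure V).restrict W),
      frameVector (ξ x) = frameVector e ∨ frameVector (ξ x) = -frameVector e := by
  have hspan_e : Submodule.span ℝ (range e) = P₀ := by
    refine Submodule.eq_of_le_of_finrank_eq (Submodule.span_le.2 (range_subset_iff.2 heP)) ?_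
    rw [finrank_span_eq_card he.linearIndependent, Fintype.card_fin, hP₀]
  filter_upwards [h.2.2.2.2, ae_restrict_mem h.1] with x hx hxW
  obtain ⟨hon, hspan⟩ := hx
  have hle : Submodule.span ℝ (range (ξ x)) ≤ P₀ := by
    rw [← SetLike.coe_subset_coe, hspan]
    exact approxTangentCone_subset_of_subset_plane P₀ p₀ h.1 hW (hW hxW)
  have hspan_ξ : Submodule.span ℝ (range (ξ x)) = P₀ := by
    refine Submodule.eq_of_le_of_finrank_eq hle ?_
    rw [finrank_span_eq_card hon.linearIndependent, Fintype.card_fin, hP₀]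
  exact frameVector_eq_or_eq_neg_of_span_eq he hon (hspan_ξ.trans hspan_e.symm)

/-- Inner-product coordinates `w ↦ (⟪e j, w⟫)ⱼ` of a frame `e`. [folklore] -/
def frameCoord {k : ℕ} (e : Fin k → V) : V →L[ℝ] (Fin k → ℝ) :=
  ContinuousLinearMap.pi fun j => innerSL ℝ (e j)

omit [FiniteDimensional ℝ V] [MeasurableSpace V] [BorelSpace V] in
/-- Unfolding `frameCoord`. [folklore] -/
@[simp] theorem frameCoord_apply {k : ℕ} (e : Fin k → V) (w : V) (j : Fin k) :
    frameCoord e w j = ⟪e j, w⟫_ℝ := rfl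

/-- **The dual covector of a frame**, `e^*(v₁, …, v_k) = det (⟪e_j, v_i⟫)` (the decomposable
covector `e₁^♭ ∧ ⋯ ∧ e_k^♭`). [cite: Federer1969, 1.7.5] -/
def frameCovector {k : ℕ} (e : Fin k → V) : Covector V k := pullbackDet (frameCoord e)

omit [FiniteDimensional ℝ V] [MeasurableSpace V] [BorelSpace V] in
/-- Unfolding `frameCovector`: `e^*(v) = det (⟪e_j, v_i⟫)`. [folklore] -/
theorem frameCovector_apply {k : ℕ} (e : Fin k → V) (v : Fin k → V) :
    frameCovector e v = (Matrix.of fun i j => ⟪e j, v i⟫_ℝ).det := rfl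

omit [FiniteDimensional ℝ V] [MeasurableSpace V] [BorelSpace V] in
/-- `e^*(e) = 1` for an orthonormal frame. [folklore] -/
theorem frameCovector_self {k : ℕ} {e : Fin k → V} (he : Orthonormal ℝ e) : frameCovector e e = 1 := by
  rw [frameCovector_apply]
  have : (Matrix.of fun i j => ⟪e j, e i⟫_ℝ) = 1 := by
    ext i j
    rw [Matrix.of_apply, orthonormal_iff_ite.1 he, Matrix.one_apply]
    simp only [eq_comm]
  rw [this, Matrix.det_one]

omit [FiniteDimensional ℝ V] [MeasurableSpace V] [BorelSpace V] in
/-- **The face covectors single out one direction**: for an orthonormal `(k+1)`-frame `e`,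
`(e ∘ i.succAbove)^* (e₀, …, ê_l, …, e_k) = δ_{il}`. [folklore] -/
theorem frameCovector_succAbove_removeNth {k : ℕ} {e : Fin (k + 1) → V} (he : Orthonormal ℝ e)
    (i l : Fin (k + 1)) :
    frameCovector (fun j => e (i.succAbove j)) (l.removeNth e) = if l = i then 1 else 0 := by
  split_ifs with hli
  · subst hli
    exact frameCovector_self (he.comp _ Fin.succAbove_right_injective)
  · obtain ⟨a, ha⟩ := Fin.exists_succAbove_eq (Ne.symm hli)
    rw [frameCovector_apply]
    refine Matrix.det_eq_zero_of_row_eq_zero a fun j => ?_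
    rw [Matrix.of_apply]
    show ⟪e (i.succAbove j), e (l.succAbove a)⟫_ℝ = 0
    rw [ha, orthonormal_iff_ite.1 he]
    simp [Fin.succAbove_ne]

omit [FiniteDimensional ℝ V] [MeasurableSpace V] [BorelSpace V] in
/-- **`d(ψ · (e ∘ i.succAbove)^*)(e₀, …, e_k) = (-1)ⁱ D_{e_i} ψ`**. [cite: Federer1969, 4.1.6] -/
theorem extDerivCLM_smulCovectorCLM_frameCovector_apply {k : ℕ} {Ω : Opens V}
    {e : Fin (k + 1) → V} (he : Orthonormal ℝ e) (i : Fin (k + 1)) (ψ : 𝓓(Ω, ℝ)) (x : V) :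
    TestForm.extDerivCLM (smulCovectorCLM (frameCovector fun j => e (i.succAbove j)) ψ) x e =
      (-1) ^ (i : ℕ) * fderiv ℝ (ψ : V → ℝ) x (e i) := by
  rw [extDerivCLM_smulCovectorCLM_apply, ContinuousAlternatingMap.alternatizeUncurryFin_apply]
  simp only [ContinuousLinearMap.smulRight_apply, ContinuousAlternatingMap.smul_apply,
    frameCovector_succAbove_removeNth he, smul_eq_mul, mul_ite, mul_one, mul_zero, smul_ite,
    smul_zero, Finset.sum_ite_eq', Finset.mem_univ, if_true, zsmul_eq_mul, Int.cast_pow,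
    Int.cast_neg, Int.cast_one]

/-- **Constancy theorem for rectifiable currents on an open face of a plane.** Let `S` be a
rectifiable `(k+1)`-current in `V`, `p₀ + P₀` an affine `(k+1)`-plane with orthonormal frame
`e`, and `U` an open set such that `U ∩ (p₀ + P₀)` is connected of finite `𝓗^{k+1}`-measure,
`spt S ∩ U ⊆ p₀ + P₀` and `∂S = 0` on `U` (i.e. on forms supported in `U`). Then
`S ⌞ U = [U ∩ (p₀ + P₀), a, e]` for an INTEGER `a`: on the face, `S` is a constant integral
multiple of the oriented plane (Federer's constancy theorem 4.1.31 (2) / 4.1.7 for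
`Γ = S`, `B` the open face, combined with the integrality of densities of rectifiable currents
4.1.28; here proved by tangency of the approximate tangent planes and mollification of the
zero-gradient density). [cite: Federer1969, 4.1.31 (2) and 4.2.3] -/
theorem Current.IsRectifiable.exists_int_restrictSet_eq_face {k : ℕ}
    {S : Current (⊤ : Opens V) (k + 1)} (hS : S.IsRectifiable) (hSr : S.IsRepresentable)
    (P₀ : Submodule ℝ V) (p₀ : V) (hP₀ : Module.finrank ℝ P₀ = k + 1)
    {e : Fin (k + 1) → V} (he : Orthonormal ℝ e) (heP : ∀ i, e i ∈ P₀)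
    {U : Set V} (hUo : IsOpen U) (hUc : IsPreconnected (U ∩ {x | x - p₀ ∈ P₀}))
    (hfin : (μHE[k + 1] : Measure V) (U ∩ {x | x - p₀ ∈ P₀}) ≠ ⊤)
    (hsupp : S.support ∩ U ⊆ {x | x - p₀ ∈ P₀})
    (hbdry : ∀ φ : TestForm (⊤ : Opens V) k, tsupport ⇑φ ⊆ U → S.boundary φ = 0) :
    ∃ a : ℤ, hSr.restrictSet U hUo.measurableSet =
      currentOfIntegration (U ∩ {x | x - p₀ ∈ P₀}) (fun _ => a) (fun _ => e) := by
  set plane : Set V := {x | x - p₀ ∈ P₀} with hplane_def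
  have hpm : MeasurableSet plane := (isClosed_plane P₀ p₀).measurableSet
  set μH : Measure V := μHE[k + 1] with hμH
  obtain ⟨⟨W, θ, ξ, hdata, rfl⟩, hcpt⟩ := hS
  -- Step 1: `S ⌞ U = [W₀, θ, ξ]`, `W₀ = W ∩ (U ∩ plane)`
  set W₀ : Set V := W ∩ (U ∩ plane) with hW₀
  have hW₀m : MeasurableSet W₀ := hdata.1.inter (hUo.measurableSet.inter hpm)
  have hdata₀ : IsRectifiableData (⊤ : Opens V) (k + 1) W₀ θ ξ :=
    hdata.inter (hUo.measurableSet.inter hpm)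
  have hW₀U : W₀ ⊆ U := fun x hx => hx.2.1
  have hW₀p : W₀ ⊆ plane := fun x hx => hx.2.2
  have hvar0 : (currentOfIntegration W θ ξ : Current (⊤ : Opens V) (k + 1)).variation
      (U \ plane) = 0 := by
    refine measure_mono_null ?_ (Current.variation_sdiff_support _)
    intro x hx
    exact ⟨trivial, fun hxs => hx.2 (hsupp ⟨hxs, hx.1⟩)⟩
  have hTU : hSr.restrictSet U hUo.measurableSet =
      (currentOfIntegration W₀ θ ξ : Current (⊤ : Opens V) (k + 1)) := by
    rw [hSr.restrictSet_congr_ae hUo.measurableSet (hUo.measurableSet.inter hpm), hW₀,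
      hdata.restrictSet_eq]
    refine ae_eq_set.2 ⟨?_, by rw [sdiff_eq_empty.2 inter_subset_left, measure_empty]⟩
    rwa [sdiff_self_inter]
  -- Step 2: the density `F = θ ξ` on `W₀`; finiteness
  set F : V → Multivector V (k + 1) := fun x => (θ x : ℝ) • frameVector (ξ x) with hFdef
  set η : V → ℝ := fun x => F x (frameCovector e) with hηdef
  set μ₀ : Measure V := μH.restrict W₀ with hμ₀
  haveI hfinμ₀ : IsFiniteMeasure μ₀ := ⟨by
    rw [hμ₀, Measure.restrict_apply_univ]
    exact (measure_mono (inter_subset_right : W₀ ⊆ U ∩ plane)).trans_lt hfin.lt_top⟩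
  have hμ₀p : μ₀ planeᶜ = 0 := by
    rw [hμ₀, Measure.restrict_apply hpm.compl]
    convert measure_empty (μ := μH)
    exact eq_empty_of_subset_empty fun x hx => hx.1 (hW₀p hx.2)
  have hmass : (currentOfIntegration W θ ξ : Current (⊤ : Opens V) (k + 1)).mass < ⊤ :=
    hdata.mass_lt_top_of_isCompact_support hcpt
  have hFint : Integrable F (μH.restrict W) := by
    have hsm : AEStronglyMeasurable F (μH.restrict W) := by
      have := hdata.2.2.2.1.aestronglyMeasurable
      rwa [show (((⊤ : Opens V) : Set V)) = univ from rfl, Measure.restrict_univ] at this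
    refine ⟨hsm, ?_⟩
    have h1 : ∫⁻ x, ‖F x‖ₑ ∂(μH.restrict W) = ∫⁻ x in W, ‖(θ x : ℝ)‖ₑ ∂μH := by
      refine lintegral_congr_ae ?_
      filter_upwards [hdata.2.2.2.2] with x hx
      rw [hFdef]
      simp only
      rw [enorm_smul, ← ofReal_norm (frameVector (ξ x)), norm_frameVector_eq_one hx.1,
        ENNReal.ofReal_one, mul_one]
    rw [HasFiniteIntegral, h1]
    exact hdata.mass_lt_top_iff.1 hmass
  have hFint₀ : Integrable F μ₀ :=
    hFint.mono_measure (Measure.restrict_mono inter_subset_left le_rfl)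
  have hη : Integrable η μ₀ :=
    (ContinuousLinearMap.apply ℝ ℝ (frameCovector e)).integrable_comp hFint₀
  -- Step 3: alignment `F = η e` a.e. on `W₀`, `η ∈ ℤ`
  have hae : ∀ᵐ x ∂μ₀, F x = η x • frameVector e ∧ ∃ n : ℤ, η x = n := by
    filter_upwards [hdata₀.ae_frameVector_eq_or P₀ p₀ hW₀p hP₀ he heP] with x hx
    have h1 : frameVector e (frameCovector e) = 1 := by
      rw [frameVector_apply, frameCovector_self he]
    rcases hx with hx | hx
    · have hη1 : η x = θ x := by
        simp only [hηdef, hFdef, hx, smul_apply, h1, smul_eq_mul, mul_one]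
      refine ⟨?_, θ x, hη1⟩
      rw [hη1]
      show (θ x : ℝ) • frameVector (ξ x) = _
      rw [hx]
    · have hη2 : η x = -(θ x : ℝ) := by
        simp only [hηdef, hFdef, hx, smul_apply, neg_apply, h1, smul_eq_mul, mul_neg, mul_one]
      refine ⟨?_, -θ x, by rw [hη2, Int.cast_neg]⟩
      rw [hη2]
      show (θ x : ℝ) • frameVector (ξ x) = _
      rw [hx, smul_neg]
      exact (neg_smul _ _).symm
  -- Step 4: `[W₀, θ, ξ](ω) = ∫ η ω(e) dμ₀`
  have happly : ∀ τ : TestForm (⊤ : Opens V) (k + 1),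
      (currentOfIntegration W₀ θ ξ : Current (⊤ : Opens V) (k + 1)) τ =
        ∫ x, η x * τ x e ∂μ₀ := by
    intro τ
    rw [currentOfIntegration_apply hdata₀.2.2.2.1]
    refine integral_congr_ae ?_
    filter_upwards [hae] with x hx
    have : (θ x : ℝ) * τ x (ξ x) = F x (τ x) := by
      simp only [hFdef, smul_apply, frameVector_apply, smul_eq_mul]
    rw [this, hx.1, smul_apply, frameVector_apply, smul_eq_mul]
  -- Step 5: the zero tangential gradient of `η μ₀`
  have hbasis : ∀ g : V → ℝ, ContDiff ℝ ∞ g → HasCompactSupport g → tsupport g ⊆ U →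
      ∀ i, ∫ x, fderiv ℝ g x (e i) * η x ∂μ₀ = 0 := by
    intro g hg hgc hgU i
    obtain ⟨ψ, hψ⟩ : ∃ ψ : 𝓓((⊤ : Opens V), ℝ), (ψ : V → ℝ) = g :=
      ⟨⟨g, hg, hgc, by simp⟩, rfl⟩
    set φ : TestForm (⊤ : Opens V) k :=
      smulCovectorCLM (frameCovector fun j => e (i.succAbove j)) ψ with hφ
    have hφx : ∀ x, φ x = ψ x • frameCovector fun j => e (i.succAbove j) := fun x => rfl
    have hφU : tsupport ⇑φ ⊆ U := by
      refine (closure_mono fun x hx => ?_).trans hgU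
      rw [mem_support] at hx ⊢
      intro h0
      exact hx (by rw [hφx, show ψ x = g x from congrFun hψ x, h0, zero_smul])
    have h0 := hbdry φ hφU
    rw [Current.boundary_apply, ← hSr.restrictSet_apply_of_support_subset hUo.measurableSet
      ((subset_tsupport _).trans ((TestForm.tsupport_extDerivCLM_subset φ).trans hφU)), hTU,
      happly] at h0
    simp_rw [hφ, extDerivCLM_smulCovectorCLM_frameCovector_apply he i ψ] at h0
    have h1 : ∫ x, η x * ((-1) ^ (i : ℕ) * fderiv ℝ (ψ : V → ℝ) x (e i)) ∂μ₀ =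
        (-1) ^ (i : ℕ) * ∫ x, fderiv ℝ g x (e i) * η x ∂μ₀ := by
      rw [← integral_const_mul]
      congr 1 with x
      rw [hψ]
      ring
    rw [h1] at h0
    simpa using h0
  have hintg : ∀ g : V → ℝ, ContDiff ℝ ∞ g → HasCompactSupport g → ∀ v : V,
      Integrable (fun x => fderiv ℝ g x v * η x) μ₀ := by
    intro g hg hgc v
    obtain ⟨C, hC⟩ := (hgc.fderiv ℝ).exists_bound_of_continuous (hg.continuous_fderiv (by simp))
    refine Integrable.mono' (hη.norm.const_mul (C * ‖v‖))
      ((((hg.continuous_fderiv (by simp)).clm_apply continuous_const).aestronglyMeasurable).mul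
        hη.1) (Eventually.of_forall fun x => ?_)
    rw [norm_mul]
    refine mul_le_mul_of_nonneg_right ((ContinuousLinearMap.le_opNorm _ _).trans ?_) (norm_nonneg _)
    exact mul_le_mul_of_nonneg_right (hC x) (norm_nonneg _)
  have hspan_e : Submodule.span ℝ (range e) = P₀ := by
    refine Submodule.eq_of_le_of_finrank_eq (Submodule.span_le.2 (range_subset_iff.2 heP)) ?_
    rw [finrank_span_eq_card he.linearIndependent, Fintype.card_fin, hP₀]
  have H : ∀ g : V → ℝ, ContDiff ℝ ∞ g → HasCompactSupport g → tsupport g ⊆ U →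
      ∀ v ∈ P₀, ∫ x, fderiv ℝ g x v * η x ∂μ₀ = 0 := by
    intro g hg hgc hgU v hv
    rw [← hspan_e] at hv
    induction hv using Submodule.span_induction with
    | mem v hv =>
      obtain ⟨i, rfl⟩ := hv
      exact hbasis g hg hgc hgU i
    | zero => simp
    | add v w _ _ ihv ihw =>
      simp_rw [map_add, add_mul]
      rw [integral_add (hintg g hg hgc v) (hintg g hg hgc w), ihv, ihw, add_zero]
    | smul r v _ ih =>
      simp_rw [map_smul, smul_eq_mul, mul_assoc]
      rw [integral_const_mul, ih, mul_zero]
  -- Step 6: the plane lemma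
  have hUc' : IsPreconnected (planeEmb P₀ p₀ ⁻¹' U) := by
    rw [← (isometry_planeEmb P₀ p₀).isEmbedding.isInducing.isPreconnected_image,
      image_preimage_eq_inter_range, range_planeEmb]
    exact hUc
  obtain ⟨c, hc⟩ := exists_const_plane μ₀ hη hμ₀p hUo hUc' H
  simp only [hP₀] at hc
  -- Step 7: `1_{W₀} η = c` a.e. on the face, and `c ∈ ℤ`
  set ρ : Measure V := μH.restrict (U ∩ plane) with hρ
  haveI : IsFiniteMeasure ρ := ⟨by rw [hρ, Measure.restrict_apply_univ]; exact hfin.lt_top⟩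
  have hρW₀ : ρ.restrict W₀ = μ₀ := by
    rw [hρ, hμ₀, Measure.restrict_restrict hW₀m, inter_eq_left.2 (inter_subset_right : W₀ ⊆ _)]
  have hηint : Integrable (W₀.indicator η) ρ := by
    rw [integrable_indicator_iff hW₀m, IntegrableOn, hρW₀]
    exact hη
  have hind : W₀.indicator η =ᵐ[ρ] fun _ => c := by
    refine ae_eq_of_forall_setIntegral_eq_of_sigmaFinite (fun s _ _ => hηint.integrableOn)
      (fun s _ _ => integrableOn_const (measure_ne_top ρ s)) fun s hs _ => ?_
    rw [setIntegral_const]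
    have e1 : ∫ x in s, W₀.indicator η x ∂ρ = ∫ x in s ∩ U, η x ∂μ₀ := by
      have hset : s ∩ (U ∩ plane) ∩ W₀ = s ∩ U ∩ W₀ := by
        ext x
        simp only [mem_inter_iff, hW₀]
        tauto
      rw [hρ, Measure.restrict_restrict hs, setIntegral_indicator hW₀m, hset, hμ₀,
        Measure.restrict_restrict (hs.inter hUo.measurableSet)]
    have e2 : ρ.real s • c = c * (μH (s ∩ U ∩ plane)).toReal := by
      rw [measureReal_def, hρ, Measure.restrict_apply hs, smul_eq_mul, mul_comm, inter_assoc]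
    rw [e1, e2]
    have hsub : s ∩ U ∩ plane ⊆ U ∩ plane := fun x hx => ⟨hx.1.2, hx.2⟩
    exact hc (s ∩ U) (hs.inter hUo.measurableSet) inter_subset_right
      (((measure_mono hsub).trans_lt hfin.lt_top).ne)
  have hint_ae : ∀ᵐ x ∂ρ, ∃ n : ℤ, W₀.indicator η x = n := by
    have h1 : ∀ᵐ x ∂ρ, x ∈ W₀ → ∃ n : ℤ, η x = n := by
      rw [← ae_restrict_iff' hW₀m, hρW₀]
      exact hae.mono fun x hx => hx.2
    filter_upwards [h1] with x hx
    by_cases hxW : x ∈ W₀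
    · rw [indicator_of_mem hxW]; exact hx hxW
    · exact ⟨0, by rw [indicator_of_notMem hxW, Int.cast_zero]⟩
  obtain ⟨a, ha⟩ : ∃ a : ℤ, W₀.indicator η =ᵐ[ρ] fun _ => (a : ℝ) := by
    by_cases hρ0 : ρ = 0
    · refine ⟨0, ?_⟩
      rw [hρ0, Filter.EventuallyEq, ae_zero]
      exact Filter.eventually_bot
    · haveI : (ae ρ).NeBot := ae_neBot.2 hρ0
      obtain ⟨x, hx1, n, hx2⟩ := (hind.and hint_ae).exists
      refine ⟨n, hind.trans (Eventually.of_forall fun y => ?_)⟩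
      show c = (n : ℝ)
      exact hx1.symm.trans hx2
  -- Step 8: the identity of currents
  refine ⟨a, ?_⟩
  rw [hTU]
  ext τ
  have hloc : LocallyIntegrableOn (fun _ : V => ((a : ℤ) : ℝ) • frameVector e)
      ((⊤ : Opens V) : Set V) (μH.restrict (U ∩ plane)) :=
    ((integrable_const _).locallyIntegrable).locallyIntegrableOn _
  rw [happly, currentOfIntegration_apply hloc]
  calc ∫ x, η x * τ x e ∂μ₀ = ∫ x in W₀, η x * τ x e ∂ρ := by rw [hρW₀]
    _ = ∫ x, W₀.indicator η x * τ x e ∂ρ := by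
        rw [← integral_indicator hW₀m]
        congr 1 with x
        by_cases hx : x ∈ W₀ <;> simp [hx]
    _ = ∫ x, (a : ℝ) * τ x e ∂ρ := by
        refine integral_congr_ae ?_
        filter_upwards [ha] with x hx
        show W₀.indicator η x * τ x e = (a : ℝ) * τ x e
        rw [hx]

end Currents

end Literature.Geometry.GeometricMeasureTheory
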